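import Summits.MatrixMultiplication.MatrixMultiplication.Theorems.AbelianSTPPCensusTB3StatDefs

/-!
# T_B static certificate, range `5216 … 5590` (t*-indexed linear checker with the k-member tree at `τ = 2375/1000`): kernel evaluation, the shape checks of the tree-heavy volumes `3136`, `3150`, `3168` on the order sub-range(s) `5279 … 5341` (volume `3150` on three order sub-sub-ranges: bounded kernel recursion)

Cell mm-stpp (rung F-M1), tier T_B = «beat `2.375` (Coppersmith–Winograd)»; checker in `AbelianSTPPCensusTB3StatDefs.lean`, table and bucket lists in `AbelianSTPPCensusTB3StatData.lean`
(pattern: theory g12's `AbelianSTPPCensusTAStatDDom*/DCk*.lean`).  `decide` with kernel reduction (standard axioms; no `native_decide`), `Elab.async false`;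
consumed by `TB3Stat.checkV_sound` / `TB3Stat.domV_sound` / `TB3Stat.m2V_sound` in the leaf `AbelianSTPPCensusLeafTB5590Closed.lean`.
WHAT THIS IS NOT: arithmetic on shape lists only; no statement about STPP families or `ω`.
-/

set_option linter.dupNamespace false
set_option autoImplicit false
set_option Elab.async false

namespace Summit.MatrixMultiplication.MatrixMultiplication.Theorems.TB3Stat

set_option maxHeartbeats 0 in
/-- Heavy volume `3150` (cell `(14,15,15)`, 191966 tree nodes over all orders), orders `5342 … 5362`: every sorted candidate shape passes `checkShape 5342 5362`. [original] -/
theorem ck3150r2s0 : TB3Stat.checkV 5342 5362 1 3150 = true := by decide +kernel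

set_option maxHeartbeats 0 in
/-- Heavy volume `3150` (cell `(14,15,15)`, 191966 tree nodes over all orders), orders `5363 … 5383`: every sorted candidate shape passes `checkShape 5363 5383`. [original] -/
theorem ck3150r2s1 : TB3Stat.checkV 5363 5383 1 3150 = true := by decide +kernel

set_option maxHeartbeats 0 in
/-- Heavy volume `3150` (cell `(14,15,15)`, 191966 tree nodes over all orders), orders `5384 … 5404`: every sorted candidate shape passes `checkShape 5384 5404`. [original] -/
theorem ck3150r2s2 : TB3Stat.checkV 5384 5404 1 3150 = true := by decide +kernel

end Summit.MatrixMultiplication.MatrixMultiplication.Theorems.TB3Stat
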